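import Literature.NumberTheory.Rogawski1990.ArchOrbFamGExtMixedJetModel        -- ★ p851386 (this seat): J1-MIXED junction `…_of_mixedModel`; brings ★ p851358 mixed tower, ★ p851340 chart junction, ★ J1 tools
import Literature.NumberTheory.Rogawski1990.ArchOrbFamGExtMixedCornerData      -- ★ p851455 (this seat): enumeration, face ∕ scalar data, regular readings; brings ★ p851409 normalisation
import Literature.NumberTheory.Rogawski1990.ArchFaceDescentTower               -- ★ p851446 (this seat): `exists_faceDescentTower`, `isCompact_setOf_conj_gprimeBlockAt_mem`
import Literature.NumberTheory.Rogawski1990.ArchOrbFamGExtMixedMatrixModel       -- ★ p851431 (F0P3a-p05 (g21)) PKG-T: `exists_partialUnfoldedModel_pi_isolate`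
import Literature.NumberTheory.Rogawski1990.ArchOrbFamGMixedCornerDress          -- ★ p851448 (F0P3a-p09 (g8)) (α): `exists_contDiff_cptTrig_eq_mul_prod_sin_mul_prod_rootProduct`
import Literature.MeasureTheory.Constructions.PiIntegralSumReindex               -- ★ p851401 (this seat): `integral_pi_readers_eq_integral_integral_sumReindex_of_integrable`
import Literature.NumberTheory.Rogawski1990.ArchOrbFamGExtSmoothInRegG           -- ★ (A5) p851150: `contDiffOn_orbFamGExt_inRegG`
import Literature.NumberTheory.Automorphic.ArchSharedRankOneDatum                -- ★ p850571: `sharedRankOneDatum_exists`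
import Literature.NumberTheory.Automorphic.UnitaryFormGroupUnimodular            -- ★ `locallyCompactSpace_unitaryGroupOfForm_complex`, `secondCountableTopology_unitaryGroupOfForm_complex`
import Literature.NumberTheory.Rogawski1990.ArchLocalBlockBoxDescentParam          -- ★ p851458 (LH3-p04 (g4)) (M2): `exists_descent_box_localOrbitalIntegral_param` (ED. 2)
import Literature.NumberTheory.Rogawski1990.ArchLocalBlockBoxDescentAdapter        -- ★ p851466 (F0P3a-p05 (g21)) (S-ad): `exists_desc_of_localDescent` (ED. 2)
import HarnessLib

/-!
# (B3-JUNCTION, MIXED CORNER) THE CLOSER — local jet bounds of `orbFamGExt` at a (0,2)-normalised mixed corner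

Sub-problem `HC_CM` of `HodgeConjecture`, route `HCCMUnconditional`, crux H413 `stub_N9` (stmt-24833), LH3 leaf `F0_P3c_StubN9Direct` v9, organ **O-L1d′-N**
`stub_N9hcCentralMixedJetBoundsNormalised : HcCentralMixedJetBoundsNormalisedStatement` (clause (I₁) of letter L1 at a MIXED corner: a scalar noncompact place AND another
nc-singular compact place; normalised so that every genuine face is a `{0,2}`-face, ★ p851409).  THEOREMS ONLY, lane `--supports stmt-HodgeConjecture-24833`.

THE ASSEMBLY (`exists_nhds_bddAbove_norm_iteratedFDeriv_orbFamGExt_of_mixedCorner_normalised_of_desc`).  At a normalised mixed cube point `x` of an admissible chart `S′`: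
the nc-singular compact places `p` split into the SCALAR places (`ℕ`-indexed `e₂ℕ`) and the FACES (`e₁`), ★ `exists_enumeration_sum_elim_bijective`; PKG-T ★
`exists_partialUnfoldedModel_pi_isolate` isolates them as a product integral over `Π_{p} G_w` of a partial model `Θ` (jointly `C^∞` near `x`, one compact block support); a cut-off in
the coordinate makes `Θ` global; ★ `integral_pi_readers_eq_integral_integral_sumReindex_of_integrable` splits `Π_p = Π_Z × Π_F` (Fubini); INSIDE the `Z`-integral the faces
descend at once by ★ `exists_faceDescentTower` over the ONE-PLACE PARAMETRIC DESCENT `hdesc` (leg (M2), LH3-p04 (g4), after centre absorption and zero propagation — taken here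
as a hypothesis schema, discharged by the (S-ad) adapter); at the scalar places the chart torus point IS the engine's `diag(ζ e^{iθ(c)})` (★ (s2)
`conj_gprimeBlockAt_eq_conj_circleDiagonal_centre_of_scalar`); the compact Weyl trig product is `v(c) · ∏ 2 sin ψ_j(c) · ∏ π(θ_k(c))` (★ (α)
`exists_contDiff_cptTrig_eq_mul_prod_sin_mul_prod_rootProduct`) — so on a neighbourhood of `x` met with `RegG S′` the extended family IS `u(c) · MIXEDTOWER_f((c, ψ(c)), θ(c))`
and ★ `exists_nhds_bddAbove_norm_iteratedFDeriv_orbFamGExt_of_mixedModel` (chart `A := id`) gives the jet bounds on `U′ ∩ InRegG` — across the compact walls too, by (I₂)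
★ `contDiffOn_orbFamGExt_inRegG`.
Harish-Chandra [Varadarajan1977, Part I §1.12, §3]; Bouaziz [Bouaziz1994IntegralesOrbitales, §3.1 (I₁)–(I₂) p. 579, §3.2 p. 580]; Shelstad [Shelstad1979, §4 pp. 22–25];
Rogawski [Rogawski1990, §4.12, §8.2 pp. 118–124]; [WarnerHASSLG2, Thm. 8.4.3.1]; [HormanderALPDO1, §1.1].
-/

noncomputable section

open MeasureTheory MeasureTheory.Measure Set Filter Topology Function Metric NumberField NumberField.InfinitePlace
open Literature.NumberTheory.Automorphic Literature.NumberTheory.Automorphic.UnitaryGroup Literature.NumberTheory.Automorphic.ArchCartan Literature.Analysis.Calculus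
open Literature.Geometry.ComplexHyperbolic.BallModel Literature.MeasureTheory.Constructions
open scoped MatrixGroups Matrix.Norms.Operator ContDiff ENNReal Classical

namespace Literature.NumberTheory.Rogawski1990

section Closer

variable (L : Type) [Field L] [NumberField L] [IsCMField L] (α : Fin 3 → L)
  [MeasurableSpace ↥(arch (↥(maximalRealSubfield L)) L (IsCMField.complexConj L) 3 (Matrix.diagonal α))]
  [BorelSpace ↥(arch (↥(maximalRealSubfield L)) L (IsCMField.complexConj L) 3 (Matrix.diagonal α))]
  (ν' : Measure ↥(arch (↥(maximalRealSubfield L)) L (IsCMField.complexConj L) 3 (Matrix.diagonal α))) [ν'.IsHaarMeasure] [ν'.IsMulRightInvariant]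

/-- **O-L1d′-N OVER THE ONE-PLACE PARAMETRIC DESCENT — (I₁) AT (0,2)-NORMALISED MIXED CORNERS.**  Hypothesis `hdesc` = the one-place parametric descent schema at every
`{0,2}`-face of an admissible chart (leg (M2) `exists_descent_box_localOrbitalIntegral_param` after centre absorption ★ p851073 and zero propagation; the binder `j` of ★
`exists_faceDescentTower`), for every rank-one Cayley carrier `U(J)` with a two-sided Haar `μ₀` and every right-invariant Haar `ν_w` on `G_w`.  Conclusion = the leaf's organ text
`HcCentralMixedJetBoundsNormalisedStatement` after the L1 frame, token for token (the `hN` binder of ★ `centralMixedJetBounds_of_normalised`).  Proof: module docstring.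
[cite: Varadarajan1977, Part I §1.12] [cite: Bouaziz1994IntegralesOrbitales, §3.1 (I₁)–(I₂) p. 579; §3.2 p. 580] [cite: Shelstad1979, §4 pp. 22–25] [cite: Rogawski1990, §8.2 pp. 118–124]
[cite: WarnerHASSLG2, Thm. 8.4.3.1] [cite: HormanderALPDO1, §1.1 Thms. 1.1.8, 1.1.9] -/
theorem exists_nhds_bddAbove_norm_iteratedFDeriv_orbFamGExt_of_mixedCorner_normalised_of_desc
    (hherm : ((Matrix.diagonal α).map (cmConjRingHom L)).transpose = Matrix.diagonal α)
    (hanis : ∀ x : Fin 3 → L, Literature.AlgebraicGeometry.ShimuraVarieties.hermForm (cmConjRingHom L) (Matrix.diagonal α) x x = 0 → x = 0)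
    (a' : ↥(arch (↥(maximalRealSubfield L)) L (IsCMField.complexConj L) 3 (Matrix.diagonal α)) → ℂ) (ha' : ArchSmooth L 3 (Matrix.diagonal α) a')
    (hdesc : ∀ {J : Matrix (Fin 2) (Fin 2) ℂ} (hJ : J = (StdForm.antidiagonal 2).over ℂ)
      [MeasurableSpace ↥(unitaryGroupOfForm (starRingEnd ℂ) J)] [BorelSpace ↥(unitaryGroupOfForm (starRingEnd ℂ) J)]
      [LocallyCompactSpace ↥(unitaryGroupOfForm (starRingEnd ℂ) J)] [SecondCountableTopology ↥(unitaryGroupOfForm (starRingEnd ℂ) J)]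
      (μ₀ : Measure ↥(unitaryGroupOfForm (starRingEnd ℂ) J)) [μ₀.IsHaarMeasure] [μ₀.IsMulRightInvariant]
      (S' : Finset {w : InfinitePlace L // IsComplex w}), (∀ w, w ∈ S' → w ∈ splitChartPlaces L α) →
      ∀ (w : {w : InfinitePlace L // IsComplex w}), w ∉ S' → w ∈ splitChartPlaces L α →
      ∀ (pw : Fin 3 → ℝ), pw 0 = pw 2 → Circle.exp (pw 0) ≠ Circle.exp (pw 1) →
      ∀ [MeasurableSpace ↥(archLocal L 3 (Matrix.diagonal α) w)] [BorelSpace ↥(archLocal L 3 (Matrix.diagonal α) w)]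
        (νw : Measure ↥(archLocal L 3 (Matrix.diagonal α) w)) [νw.IsHaarMeasure] [νw.IsMulRightInvariant],
      ∀ (P : Type) [NormedAddCommGroup P] [NormedSpace ℝ P] [FiniteDimensional ℝ P] (Θ : P × Matrix (Fin 3) (Fin 3) ℂ → ℂ),
        ContDiff ℝ ∞ Θ → ∀ C : Set (Matrix (Fin 3) (Fin 3) ℂ), IsCompact C → (∀ (π : P) (X : Matrix (Fin 3) (Fin 3) ℂ), X ∉ C → Θ (π, X) = 0) →
        ∃ (K : ℝ) (U : Set (Fin 3 → ℝ)) (f : (P × (Fin 3 → ℝ)) × Matrix (Fin 2) (Fin 2) ℂ → ℂ) (C' : Set (Matrix (Fin 2) (Fin 2) ℂ)),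
          K ≠ 0 ∧ IsOpen U ∧ pw ∈ U ∧ ContDiff ℝ ∞ f ∧ IsCompact C' ∧ (∀ (q : P × (Fin 3 → ℝ)) (X : Matrix (Fin 2) (Fin 2) ℂ), X ∉ C' → f (q, X) = 0) ∧
          (∀ π : P, (∀ X, Θ (π, X) = 0) → ∀ (cw : Fin 3 → ℝ) (X : Matrix (Fin 2) (Fin 2) ℂ), f ((π, cw), X) = 0) ∧
          ∀ (π : P) (cw : Fin 3 → ℝ), cw ∈ U → Injective (fun i : Fin 3 => Circle.exp (cw i)) →
            ∫ g : ↥(archLocal L 3 (Matrix.diagonal α) w),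
                Θ (π, (((g * gprimeBlockAt L α w S' cw * g⁻¹ : ↥(archLocal L 3 (Matrix.diagonal α) w)) : GL (Fin 3) ℂ) : Matrix (Fin 3) (Fin 3) ℂ)) ∂νw =
              K • ∫ h : ↥(unitaryGroupOfForm (starRingEnd ℂ) J),
                f ((π, cw), (((h * ⟨Matrix.GeneralLinearGroup.mkOfDetNeZero !![(1 : ℂ), 1; 1, -1] det_cayleyTwo_ne_zero *
                    circleDiagonal 2 ![Circle.exp ((cw 0 - cw 2) / 2), Circle.exp (-((cw 0 - cw 2) / 2))] *
                    (Matrix.GeneralLinearGroup.mkOfDetNeZero !![(1 : ℂ), 1; 1, -1] det_cayleyTwo_ne_zero)⁻¹, cayley_conj_circleDiagonal_mem_of_eq_over hJ _⟩ * h⁻¹ :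
                  ↥(unitaryGroupOfForm (starRingEnd ℂ) J)) : GL (Fin 2) ℂ) : Matrix (Fin 2) (Fin 2) ℂ)) ∂μ₀) :
    ∀ (S' : Finset {w : InfinitePlace L // IsComplex w}), (∀ w, w ∈ S' → w ∈ splitChartPlaces L α) →
      ∀ (n : ℕ) (x : {w : InfinitePlace L // IsComplex w} → Fin 3 → ℝ),
      (∀ w' : {w : InfinitePlace L // IsComplex w}, w' ∉ S' → ∀ l : Fin 3, x w' l ∈ Ico 0 (2 * Real.pi)) →
      (∃ w : {w : InfinitePlace L // IsComplex w}, w ∉ S' ∧ (∃ i j : Fin 3, i ≠ j ∧ slotSign L α w i ≠ slotSign L α w j) ∧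
        (∀ l l' : Fin 3, Circle.exp (x w l) = Circle.exp (x w l')) ∧
        ∃ w', w' ∉ S' ∧ w' ≠ w ∧ ∃ i' j' : Fin 3, i' ≠ j' ∧ slotSign L α w' i' ≠ slotSign L α w' j' ∧ Circle.exp (x w' i') = Circle.exp (x w' j')) →
      (∀ w' : {w : InfinitePlace L // IsComplex w}, w' ∉ S' → slotSign L α w' 1 ≠ slotSign L α w' 2 →
        Circle.exp (x w' 1) = Circle.exp (x w' 2) → Circle.exp (x w' 0) = Circle.exp (x w' 1)) →
      ∃ U ∈ 𝓝 x, BddAbove ((fun c => ‖iteratedFDeriv ℝ n (orbFamGExt L α ν' a' S') c‖) '' (U ∩ InRegG (slotSign L α) S')) := by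
  intro S' hS' n x hcube hmix hnorm
  -- the frame
  have hα : ∀ i, α i ≠ 0 := ne_zero_of_diagonal_anisotropic hanis
  have hreal : ∀ (w' : {w : InfinitePlace L // IsComplex w}) (i : Fin 3), (w'.1.embedding (α i)).im = 0 :=
    im_embedding_diagonal_eq_zero L 3 α (complexConj_apply_eq_of_diagonal_frame hherm)
  -- the rank-one Cayley carrier `U(J)` with a two-sided Haar measure, and the Borel structures on the local groups
  obtain ⟨J, hJ⟩ : ∃ J : Matrix (Fin 2) (Fin 2) ℂ, J = (StdForm.antidiagonal 2).over ℂ := ⟨_, rfl⟩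
  letI : MeasurableSpace ↥(unitaryGroupOfForm (starRingEnd ℂ) J) := borel _
  haveI : BorelSpace ↥(unitaryGroupOfForm (starRingEnd ℂ) J) := ⟨rfl⟩
  haveI : LocallyCompactSpace ↥(unitaryGroupOfForm (starRingEnd ℂ) J) := locallyCompactSpace_unitaryGroupOfForm_complex J
  haveI : SecondCountableTopology ↥(unitaryGroupOfForm (starRingEnd ℂ) J) := secondCountableTopology_unitaryGroupOfForm_complex J
  letI : MeasurableSpace (↥(unitaryGroupOfForm (starRingEnd ℂ) J) ⧸ torusU (starRingEnd ℂ) J) := borel _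
  haveI : BorelSpace (↥(unitaryGroupOfForm (starRingEnd ℂ) J) ⧸ torusU (starRingEnd ℂ) J) := ⟨rfl⟩
  obtain ⟨μ₀, hμ₀H, hμ₀R, -⟩ := sharedRankOneDatum_exists hJ
  haveI := hμ₀H
  haveI := hμ₀R
  letI : ∀ w : {w : InfinitePlace L // IsComplex w}, MeasurableSpace ↥(archLocal L 3 (Matrix.diagonal α) w) := fun w => borel _
  haveI : ∀ w : {w : InfinitePlace L // IsComplex w}, BorelSpace ↥(archLocal L 3 (Matrix.diagonal α) w) := fun w => ⟨rfl⟩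
  -- STEP 1: the nc-singular places `p`, scalar places, faces; enumeration
  obtain ⟨w₀, hw₀S, -, hsc₀, -⟩ := hmix
  obtain ⟨p, hpdef⟩ : ∃ p : {w : InfinitePlace L // IsComplex w} → Prop,
      p = fun w => w ∉ S' ∧ ∃ i j : Fin 3, i ≠ j ∧ slotSign L α w i ≠ slotSign L α w j ∧ Circle.exp (x w i) = Circle.exp (x w j) := ⟨_, rfl⟩
  have hpiff : ∀ w, p w ↔ (w ∉ S' ∧ ∃ i j : Fin 3, i ≠ j ∧ slotSign L α w i ≠ slotSign L α w j ∧ Circle.exp (x w i) = Circle.exp (x w j)) :=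
    fun w => by rw [hpdef]
  obtain ⟨m₁, m₂, e₂ℕ, e₁, h₂p, h₁p, hbij, h₂sc, h₁nsc, h₂inj, h₁inj, hdisj⟩ :=
    exists_enumeration_sum_elim_bijective p (fun w : {w : InfinitePlace L // IsComplex w} => ∀ l l' : Fin 3, Circle.exp (x w l) = Circle.exp (x w l')) w₀
  set eσ := Equiv.ofBijective _ hbij with heσ
  have hp : ∀ w : {w : InfinitePlace L // IsComplex w}, p w → w ∉ S' := fun w hw => ((hpiff w).1 hw).1
  have hxin : ∀ w : {w : InfinitePlace L // IsComplex w}, w ∉ S' → ¬ p w →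
      ∀ i j : Fin 3, i ≠ j → slotSign L α w i ≠ slotSign L α w j → Circle.exp (x w i) ≠ Circle.exp (x w j) :=
    fun w hw hnp i j hij hs hc => hnp ((hpiff w).2 ⟨hw, i, j, hij, hs, hc⟩)
  -- face data and scalar data
  have hface : ∀ j : Fin m₁, x (e₁ j) 0 = x (e₁ j) 2 ∧ Circle.exp (x (e₁ j) 0) ≠ Circle.exp (x (e₁ j) 1) ∧ e₁ j ∈ splitChartPlaces L α :=
    fun j => faceData_of_normalised L α hα hcube hnorm ((hpiff _).1 (h₁p j)).1 (hreal _) ((hpiff _).1 (h₁p j)).2 (h₁nsc j)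
  have he₁S : ∀ j : Fin m₁, e₁ j ∉ S' := fun j => ((hpiff _).1 (h₁p j)).1
  have he₂S : ∀ k : Fin m₂, e₂ℕ k.val ∉ S' := fun k => ((hpiff _).1 (h₂p k)).1
  have hxsc : ∀ (k : Fin m₂) (l l' : Fin 3), x (e₂ℕ k.val) l = x (e₂ℕ k.val) l' :=
    fun k => scalar_literal_of_cube L hcube (he₂S k) (h₂sc k)
  -- STEP 2: PKG-T
  obtain ⟨νl, hνlH, hνlR, U₀, u₀, Θ, C, hU₀o, hxU₀, hu₀, hΘ, hC, hΘC, hfacT⟩ :=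
    exists_partialUnfoldedModel_pi_isolate L α ν' hα hreal hS' ha' p hp hxin
  haveI : ∀ w : {w : InfinitePlace L // IsComplex w}, (νl w).IsHaarMeasure := hνlH
  haveI : ∀ w : {w : InfinitePlace L // IsComplex w}, (νl w).IsMulRightInvariant := hνlR
  haveI : ∀ w : {w : InfinitePlace L // IsComplex w}, LocallyCompactSpace (archLocal L 3 (Matrix.diagonal α) w) := fun w => locallyCompactSpace_archLocal L 3 (Matrix.diagonal α) w
  haveI : ∀ w : {w : InfinitePlace L // IsComplex w}, SecondCountableTopology (archLocal L 3 (Matrix.diagonal α) w) := fun w => secondCountableTopology_archLocal L 3 (Matrix.diagonal α) w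
  -- STEP 3: the coordinate cut-off making the partial model global
  obtain ⟨χ, hχd, -, hχU, hχ1⟩ := exists_contDiff_tsupport_subset_eventually_eq_one (hU₀o.mem_nhds hxU₀)
  obtain ⟨O₁, hO₁1, hO₁o, hxO₁⟩ := _root_.mem_nhds_iff.1 hχ1
  obtain ⟨Θχ, hΘχdef⟩ : ∃ Θχ : ({w : InfinitePlace L // IsComplex w} → Fin 3 → ℝ) ×
      ({w : {w : InfinitePlace L // IsComplex w} // p w} →
        Matrix (Fin 3) (Fin 3) ℂ) → ℂ, Θχ = fun q => (χ q.1 : ℝ) • Θ q := ⟨_, rfl⟩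
  have hΘχd : ContDiff ℝ ∞ Θχ := by
    rw [hΘχdef, contDiff_iff_contDiffAt]
    intro q
    by_cases hq : q.1 ∈ U₀
    · have hnhds : U₀ ×ˢ (univ : Set ({w : {w : InfinitePlace L // IsComplex w} // p w} → Matrix (Fin 3) (Fin 3) ℂ)) ∈ 𝓝 q := by
        rw [← Prod.mk.eta (p := q)]; exact prod_mem_nhds (hU₀o.mem_nhds hq) univ_mem
      exact ((hχd.comp contDiff_fst).contDiffAt).smul (hΘ.contDiffAt hnhds)
    · have hq' : q.1 ∉ tsupport χ := fun h => hq (hχU h)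
      have hev : χ =ᶠ[𝓝 q.1] 0 := notMem_tsupport_iff_eventuallyEq.1 hq'
      have hev2 : (fun q' : ({w : InfinitePlace L // IsComplex w} → Fin 3 → ℝ) ×
          ({w : {w : InfinitePlace L // IsComplex w} // p w} →
            Matrix (Fin 3) (Fin 3) ℂ) => (χ q'.1 : ℝ) • Θ q') =ᶠ[𝓝 q] fun _ => 0 :=
        (continuous_fst.continuousAt.eventually hev).mono fun q' hq' => by
          show (χ q'.1 : ℝ) • Θ q' = 0
          rw [show χ q'.1 = 0 from hq', zero_smul]
      exact contDiffAt_const.congr_of_eventuallyEq hev2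
  have hΘχC : ∀ c Y, (∃ w, Y w ∉ C) → Θχ (c, Y) = 0 := fun c Y hY => by
    rw [hΘχdef]; show (χ c : ℝ) • Θ (c, Y) = 0; rw [hΘC c Y hY, smul_zero]
  have hΘχ1 : ∀ c ∈ O₁, ∀ Y, Θχ (c, Y) = Θ (c, Y) := fun c hc Y => by
    rw [hΘχdef]; show (χ c : ℝ) • Θ (c, Y) = Θ (c, Y); rw [show χ c = 1 from hO₁1 hc, one_smul]
  -- STEP 4: the face tower INSIDE the `Z`-integral: glue, the face family `ΘF`, the descent
  obtain ⟨ΘF, hΘFdef⟩ : ∃ ΘF : (({w : InfinitePlace L // IsComplex w} → Fin 3 → ℝ) × (Fin m₂ → Matrix (Fin 3) (Fin 3) ℂ)) × (Fin m₁ → Matrix (Fin 3) (Fin 3) ℂ) → ℂ,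
      ΘF = fun q => Θχ (q.1.1, fun i => Sum.elim q.1.2 q.2 (eσ.symm i)) := ⟨_, rfl⟩
  have hglue : ContDiff ℝ ∞ fun q : (({w : InfinitePlace L // IsComplex w} → Fin 3 → ℝ) × (Fin m₂ → Matrix (Fin 3) (Fin 3) ℂ)) × (Fin m₁ → Matrix (Fin 3) (Fin 3) ℂ) =>
      fun i => Sum.elim q.1.2 q.2 (eσ.symm i) := by
    refine contDiff_pi.2 fun i => ?_
    rcases hs : eσ.symm i with k | j
    · simp only [Sum.elim_inl]
      exact (contDiff_apply ℝ (Matrix (Fin 3) (Fin 3) ℂ) k).comp (contDiff_snd.comp contDiff_fst)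
    · simp only [Sum.elim_inr]
      exact (contDiff_apply ℝ (Matrix (Fin 3) (Fin 3) ℂ) j).comp contDiff_snd
  have hΘFd : ContDiff ℝ ∞ ΘF := by
    rw [hΘFdef]; exact hΘχd.comp ((contDiff_fst.comp contDiff_fst).prodMk hglue)
  have hΘFC : ∀ (π : ({w : InfinitePlace L // IsComplex w} → Fin 3 → ℝ) × (Fin m₂ → Matrix (Fin 3) (Fin 3) ℂ)) (X₁ : Fin m₁ → Matrix (Fin 3) (Fin 3) ℂ),
      (∃ j, X₁ j ∉ C) → ΘF (π, X₁) = 0 := by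
    rintro π X₁ ⟨j, hj⟩
    rw [hΘFdef]
    refine hΘχC _ _ ⟨eσ (Sum.inr j), ?_⟩
    rw [Equiv.symm_apply_apply, Sum.elim_inr]
    exact hj
  have hΘFC₂ : ∀ (c : {w : InfinitePlace L // IsComplex w} → Fin 3 → ℝ) (X₂ : Fin m₂ → Matrix (Fin 3) (Fin 3) ℂ) (X₁ : Fin m₁ → Matrix (Fin 3) (Fin 3) ℂ),
      (∃ k, X₂ k ∉ C) → ΘF ((c, X₂), X₁) = 0 := by
    rintro c X₂ X₁ ⟨k, hk⟩
    rw [hΘFdef]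
    refine hΘχC _ _ ⟨eσ (Sum.inl k), ?_⟩
    rw [Equiv.symm_apply_apply, Sum.elim_inl]
    exact hk
  obtain ⟨K, UF, fF, C', hK, hUFo, hxUF, hfF, hC', hfFC, hfFZ, hfFI⟩ :=
    exists_faceDescentTower L α S' νl hJ μ₀ hα m₁ e₁ (fun j => x (e₁ j)) (fun j => he₁S j)
      (fun j => hdesc hJ μ₀ S' hS' (e₁ j) (he₁S j) (hface j).2.2 (x (e₁ j)) (hface j).1 (hface j).2.1 (νl (e₁ j)))
      ((({w : InfinitePlace L // IsComplex w} → Fin 3 → ℝ) × (Fin m₂ → Matrix (Fin 3) (Fin 3) ℂ))) ΘF hΘFd C hC hΘFC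
  -- STEP 5: the charts `Φ₁` (faces), `Φ₂` (relabelled scalar angles), the dress `v`, the tower base `fT`, the neighbourhood `U'`
  obtain ⟨Φ₁, hΦ₁⟩ : ∃ Φ₁ : ({w : InfinitePlace L // IsComplex w} → Fin 3 → ℝ) →L[ℝ] (Fin m₁ → ℝ), ∀ c j, Φ₁ c j = (c (e₁ j) 0 - c (e₁ j) 2) / 2 :=
    ⟨ContinuousLinearMap.pi fun j : Fin m₁ => (1 / 2 : ℝ) •
      ((ContinuousLinearMap.proj (R := ℝ) (φ := fun _ : Fin 3 => ℝ) 0).comp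
          (ContinuousLinearMap.proj (R := ℝ) (φ := fun _ : {w : InfinitePlace L // IsComplex w} => Fin 3 → ℝ) (e₁ j)) -
        (ContinuousLinearMap.proj (R := ℝ) (φ := fun _ : Fin 3 => ℝ) 2).comp
          (ContinuousLinearMap.proj (R := ℝ) (φ := fun _ : {w : InfinitePlace L // IsComplex w} => Fin 3 → ℝ) (e₁ j))),
      fun c j => by
        simp only [ContinuousLinearMap.pi_apply, FunLike.coe_smul, FunLike.coe_sub, Pi.smul_apply, Pi.sub_apply,
          ContinuousLinearMap.coe_comp, Function.comp_apply, ContinuousLinearMap.proj_apply, smul_eq_mul]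
        ring⟩
  obtain ⟨Φ₂, hΦ₂⟩ : ∃ Φ₂ : ({w : InfinitePlace L // IsComplex w} → Fin 3 → ℝ) →L[ℝ] (Fin m₂ → Fin 3 → ℝ),
      ∀ c k l, Φ₂ c k l = c (e₂ℕ k.val) ((lineOf (formSign L α (e₂ℕ k.val))).symm l) :=
    ⟨ContinuousLinearMap.pi fun k : Fin m₂ => ContinuousLinearMap.pi fun l : Fin 3 =>
      (ContinuousLinearMap.proj (R := ℝ) (φ := fun _ : Fin 3 => ℝ) ((lineOf (formSign L α (e₂ℕ k.val))).symm l)).comp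
        (ContinuousLinearMap.proj (R := ℝ) (φ := fun _ : {w : InfinitePlace L // IsComplex w} => Fin 3 → ℝ) (e₂ℕ k.val)),
      fun c k l => rfl⟩
  obtain ⟨v, hv, hvfac⟩ := exists_contDiff_cptTrig_eq_mul_prod_sin_mul_prod_rootProduct S' x e₁ (fun k : Fin m₂ => e₂ℕ k.val) h₁inj
    (fun k k' h => h₂inj k k' h) (fun j k => hdisj j k) he₁S he₂S (fun k => lineOf (formSign L α (e₂ℕ k.val))) hxsc
  obtain ⟨fT, hfTdef⟩ : ∃ fT : ({w : InfinitePlace L // IsComplex w} → Fin 3 → ℝ) × ((Fin m₁ → Matrix (Fin 2) (Fin 2) ℂ) × (Fin m₂ → Matrix (Fin 3) (Fin 3) ℂ)) → ℂ,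
      fT = fun q => fF (((q.1, q.2.2), fun j => q.1 (e₁ j)), q.2.1) := ⟨_, rfl⟩
  obtain ⟨A, hAdef⟩ : ∃ A : ({w : InfinitePlace L // IsComplex w} → Fin 3 → ℝ) →L[ℝ] ({w : InfinitePlace L // IsComplex w} → Fin 3 → ℝ),
      A = ContinuousLinearMap.id ℝ _ := ⟨_, rfl⟩
  have hA : ∀ c, A c = c := fun c => by rw [hAdef]; rfl
  obtain ⟨ζ, hζdef⟩ : ∃ ζ : {w : InfinitePlace L // IsComplex w} → Circle, ζ = fun w => Circle.exp (x w 0) := ⟨_, rfl⟩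
  have hζ : ∀ w, ζ w = Circle.exp (x w 0) := fun w => by rw [hζdef]
  obtain ⟨uu, huudef⟩ : ∃ uu : ({w : InfinitePlace L // IsComplex w} → Fin 3 → ℝ) → ℂ, uu = fun c => v c * u₀ c * (K : ℂ) := ⟨_, rfl⟩
  set U' : Set ({w : InfinitePlace L // IsComplex w} → Fin 3 → ℝ) := O₁ ∩ U₀ ∩ (fun c => fun j => c (e₁ j)) ⁻¹' UF with hU'
  have hcwFc : Continuous fun c : {w : InfinitePlace L // IsComplex w} → Fin 3 → ℝ => fun j => c (e₁ j) := continuous_pi fun j => continuous_apply (e₁ j)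
  have hU'n : U' ∈ 𝓝 x := inter_mem (inter_mem (hO₁o.mem_nhds hxO₁) (hU₀o.mem_nhds hxU₀)) (hcwFc.continuousAt.preimage_mem_nhds (hUFo.mem_nhds hxUF))
  -- STEP 6: THE MODEL IDENTITY on `U' ∩ RegG S'`
  have hmodel : ∀ c ∈ U' ∩ RegG S', orbFamGExt L α ν' a' S' c =
      uu c * ((∏ k : Fin m₂, rootProduct ((Φ₂ c - Φ₂ x) k)) • ∫ g : ((k : Fin m₂) → ↥(archLocal L 3 (Matrix.diagonal α) (e₂ℕ k.val))),
          (fun z' : (({w : InfinitePlace L // IsComplex w} → Fin 3 → ℝ) × (Fin m₁ → ℝ)) × (Fin m₂ → Matrix (Fin 3) (Fin 3) ℂ) =>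
        ((∏ k : Fin m₁, 2 * Real.sin (z'.1.2 k)) • ∫ h : Fin m₁ → ↥(unitaryGroupOfForm (starRingEnd ℂ) J),
          (fun y : (({w : InfinitePlace L // IsComplex w} → Fin 3 → ℝ) × (Fin m₂ → Matrix (Fin 3) (Fin 3) ℂ)) × (Fin m₁ → Matrix (Fin 2) (Fin 2) ℂ) => fT (y.1.1, (y.2, y.1.2)))
            ((z'.1.1, z'.2), fun k => (((h k * ⟨Matrix.GeneralLinearGroup.mkOfDetNeZero !![(1 : ℂ), 1; 1, -1] det_cayleyTwo_ne_zero * circleDiagonal 2 ![Circle.exp (z'.1.2 k), Circle.exp (-(z'.1.2 k))] * (Matrix.GeneralLinearGroup.mkOfDetNeZero !![(1 : ℂ), 1; 1, -1] det_cayleyTwo_ne_zero)⁻¹, cayley_conj_circleDiagonal_mem_of_eq_over hJ _⟩ * (h k)⁻¹ : ↥(unitaryGroupOfForm (starRingEnd ℂ) J)) : GL (Fin 2) ℂ) : Matrix (Fin 2) (Fin 2) ℂ)) ∂(Measure.pi fun _ : Fin m₁ => μ₀)))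
            ((A c, Φ₁ c), fun k => (((g k * (⟨circleDiagonal 3 (fun i => ζ (e₂ℕ k.val) * Circle.exp ((Φ₂ c - Φ₂ x) k i)), circleDiagonal_mem_archLocal_diagonal L 3 α (e₂ℕ k.val) _⟩ : ↥(archLocal L 3 (Matrix.diagonal α) (e₂ℕ k.val))) * (g k)⁻¹ : ↥(archLocal L 3 (Matrix.diagonal α) (e₂ℕ k.val))) : GL (Fin 3) ℂ) : Matrix (Fin 3) (Fin 3) ℂ))
            ∂(Measure.pi fun k : Fin m₂ => νl (e₂ℕ k.val))) := by
    rintro c ⟨⟨⟨hcO₁, hcU₀⟩, hcUF⟩, hcreg⟩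
    rw [hA c, huudef]
    simp only [hζ]
    have hregF : ∀ j : Fin m₁, Injective fun i : Fin 3 => Circle.exp (c (e₁ j) i) := fun j => hcreg.1 _ (he₁S j)
    -- (6a) integrability on `Π_p G_w` at the regular point `c`
    have hΘeq : ∀ Y, Θ (c, Y) = Θχ (c, Y) := fun Y => (hΘχ1 c hcO₁ Y).symm
    have hint : Integrable (fun g : (∀ w : {w : {w : InfinitePlace L // IsComplex w} // p w}, ↥(archLocal L 3 (Matrix.diagonal α) w.1)) => Θ (c, fun w => (((g w * gprimeBlockAt L α w.1 S' (c w.1) * (g w)⁻¹ : ↥(archLocal L 3 (Matrix.diagonal α) w.1)) : GL (Fin 3) ℂ) : Matrix (Fin 3) (Fin 3) ℂ)))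
        (Measure.pi fun w : {w : {w : InfinitePlace L // IsComplex w} // p w} => νl w.1) := by
      have hΘc : Continuous fun Y : {w : {w : InfinitePlace L // IsComplex w} // p w} → Matrix (Fin 3) (Fin 3) ℂ => Θχ (c, Y) :=
        hΘχd.continuous.comp (continuous_const.prodMk continuous_id)
      have hA : Continuous fun g : (∀ w : {w : {w : InfinitePlace L // IsComplex w} // p w}, ↥(archLocal L 3 (Matrix.diagonal α) w.1)) => fun w => (((g w * gprimeBlockAt L α w.1 S' (c w.1) * (g w)⁻¹ : ↥(archLocal L 3 (Matrix.diagonal α) w.1)) : GL (Fin 3) ℂ) : Matrix (Fin 3) (Fin 3) ℂ) :=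
        continuous_pi fun w => (Units.continuous_val.comp continuous_subtype_val).comp ((((continuous_apply w).mul continuous_const)).mul (continuous_apply w).inv)
      have hS : ∀ w : {w : {w : InfinitePlace L // IsComplex w} // p w}, IsCompact {g : ↥(archLocal L 3 (Matrix.diagonal α) w.1) | (((g * gprimeBlockAt L α w.1 S' (c w.1) * (g)⁻¹ : ↥(archLocal L 3 (Matrix.diagonal α) w.1)) : GL (Fin 3) ℂ) : Matrix (Fin 3) (Fin 3) ℂ) ∈ C} :=
        fun w => isCompact_setOf_conj_gprimeBlockAt_mem L α S' hα (hp _ w.2) (hcreg.1 _ (hp _ w.2)) hC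
      have hintχ : Integrable (fun g : (∀ w : {w : {w : InfinitePlace L // IsComplex w} // p w}, ↥(archLocal L 3 (Matrix.diagonal α) w.1)) => Θχ (c, fun w => (((g w * gprimeBlockAt L α w.1 S' (c w.1) * (g w)⁻¹ : ↥(archLocal L 3 (Matrix.diagonal α) w.1)) : GL (Fin 3) ℂ) : Matrix (Fin 3) (Fin 3) ℂ)))
          (Measure.pi fun w : {w : {w : InfinitePlace L // IsComplex w} // p w} => νl w.1) := by
        refine (hΘc.comp hA).integrable_of_hasCompactSupport ?_
        refine HasCompactSupport.intro (isCompact_univ_pi hS) fun g hg => ?_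
        simp only [mem_univ_pi, mem_setOf_eq, not_forall] at hg
        obtain ⟨w, hw⟩ := hg
        exact hΘχC _ _ ⟨w, hw⟩
      exact hintχ.congr (Filter.Eventually.of_forall fun g => (hΘeq _).symm)
    -- (6b) split `Π_p = Π_Z × Π_F` and Fubini (★ sum reindex), then transport to the enumerations `e₂ℕ`, `e₁`
    have hI2 := integral_pi_readers_eq_integral_integral_sumReindex_of_integrable (fun w : {w : {w : InfinitePlace L // IsComplex w} // p w} => νl w.1) eσ
      (fun (w : {w : {w : InfinitePlace L // IsComplex w} // p w}) (g : ↥(archLocal L 3 (Matrix.diagonal α) w.1)) => (((g * gprimeBlockAt L α w.1 S' (c w.1) * (g)⁻¹ : ↥(archLocal L 3 (Matrix.diagonal α) w.1)) : GL (Fin 3) ℂ) : Matrix (Fin 3) (Fin 3) ℂ)) (fun Y => Θ (c, Y)) hint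
    have heqZ : (fun a : Fin m₂ => (eσ (Sum.inl a)).1) = fun k => e₂ℕ k.val := by
      funext a; rw [heσ, Equiv.ofBijective_apply, Sum.elim_inl]
    have heqF : (fun b : Fin m₁ => (eσ (Sum.inr b)).1) = e₁ := by
      funext b; rw [heσ, Equiv.ofBijective_apply, Sum.elim_inr]
    have hVAL : ∀ (eZ eZ' : Fin m₂ → {w : InfinitePlace L // IsComplex w}) (eF eF' : Fin m₁ → {w : InfinitePlace L // IsComplex w}), eZ = eZ' → eF = eF' →
        (∫ gZ : ((a : Fin m₂) → ↥(archLocal L 3 (Matrix.diagonal α) (eZ a))), ∫ gF : ((b : Fin m₁) → ↥(archLocal L 3 (Matrix.diagonal α) (eF b))),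
          Θ (c, fun i => Sum.elim (fun a => (((gZ a * gprimeBlockAt L α (eZ a) S' (c (eZ a)) * (gZ a)⁻¹ : ↥(archLocal L 3 (Matrix.diagonal α) (eZ a))) : GL (Fin 3) ℂ) : Matrix (Fin 3) (Fin 3) ℂ)) (fun b => (((gF b * gprimeBlockAt L α (eF b) S' (c (eF b)) * (gF b)⁻¹ : ↥(archLocal L 3 (Matrix.diagonal α) (eF b))) : GL (Fin 3) ℂ) : Matrix (Fin 3) (Fin 3) ℂ)) (eσ.symm i))
          ∂(Measure.pi fun b : Fin m₁ => νl (eF b)) ∂(Measure.pi fun a : Fin m₂ => νl (eZ a))) =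
        (∫ gZ : ((a : Fin m₂) → ↥(archLocal L 3 (Matrix.diagonal α) (eZ' a))), ∫ gF : ((b : Fin m₁) → ↥(archLocal L 3 (Matrix.diagonal α) (eF' b))),
          Θ (c, fun i => Sum.elim (fun a => (((gZ a * gprimeBlockAt L α (eZ' a) S' (c (eZ' a)) * (gZ a)⁻¹ : ↥(archLocal L 3 (Matrix.diagonal α) (eZ' a))) : GL (Fin 3) ℂ) : Matrix (Fin 3) (Fin 3) ℂ)) (fun b => (((gF b * gprimeBlockAt L α (eF' b) S' (c (eF' b)) * (gF b)⁻¹ : ↥(archLocal L 3 (Matrix.diagonal α) (eF' b))) : GL (Fin 3) ℂ) : Matrix (Fin 3) (Fin 3) ℂ)) (eσ.symm i))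
          ∂(Measure.pi fun b : Fin m₁ => νl (eF' b)) ∂(Measure.pi fun a : Fin m₂ => νl (eZ' a))) := by
      rintro _ _ _ _ rfl rfl; rfl
    have hI2' : (∫ g : (∀ w : {w : {w : InfinitePlace L // IsComplex w} // p w}, ↥(archLocal L 3 (Matrix.diagonal α) w.1)), Θ (c, fun w => (((g w * gprimeBlockAt L α w.1 S' (c w.1) * (g w)⁻¹ : ↥(archLocal L 3 (Matrix.diagonal α) w.1)) : GL (Fin 3) ℂ) : Matrix (Fin 3) (Fin 3) ℂ)) ∂(Measure.pi fun w : {w : {w : InfinitePlace L // IsComplex w} // p w} => νl w.1)) =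
        ∫ gZ : ((k : Fin m₂) → ↥(archLocal L 3 (Matrix.diagonal α) (e₂ℕ k.val))), ∫ gF : ((j : Fin m₁) → ↥(archLocal L 3 (Matrix.diagonal α) (e₁ j))),
          Θ (c, fun i => Sum.elim (fun k => (((gZ k * gprimeBlockAt L α (e₂ℕ k.val) S' (c (e₂ℕ k.val)) * (gZ k)⁻¹ : ↥(archLocal L 3 (Matrix.diagonal α) (e₂ℕ k.val))) : GL (Fin 3) ℂ) : Matrix (Fin 3) (Fin 3) ℂ)) (fun j => (((gF j * gprimeBlockAt L α (e₁ j) S' (c (e₁ j)) * (gF j)⁻¹ : ↥(archLocal L 3 (Matrix.diagonal α) (e₁ j))) : GL (Fin 3) ℂ) : Matrix (Fin 3) (Fin 3) ℂ)) (eσ.symm i))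
          ∂(Measure.pi fun j : Fin m₁ => νl (e₁ j)) ∂(Measure.pi fun k : Fin m₂ => νl (e₂ℕ k.val)) :=
      hI2.trans (hVAL _ _ _ _ heqZ heqF)
    -- (6c) the face tower inside the `Z`-integral
    have hI3 : (fun gZ : ((k : Fin m₂) → ↥(archLocal L 3 (Matrix.diagonal α) (e₂ℕ k.val))) => ∫ gF : ((j : Fin m₁) → ↥(archLocal L 3 (Matrix.diagonal α) (e₁ j))),
          Θ (c, fun i => Sum.elim (fun k => (((gZ k * gprimeBlockAt L α (e₂ℕ k.val) S' (c (e₂ℕ k.val)) * (gZ k)⁻¹ : ↥(archLocal L 3 (Matrix.diagonal α) (e₂ℕ k.val))) : GL (Fin 3) ℂ) : Matrix (Fin 3) (Fin 3) ℂ)) (fun j => (((gF j * gprimeBlockAt L α (e₁ j) S' (c (e₁ j)) * (gF j)⁻¹ : ↥(archLocal L 3 (Matrix.diagonal α) (e₁ j))) : GL (Fin 3) ℂ) : Matrix (Fin 3) (Fin 3) ℂ)) (eσ.symm i))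
          ∂(Measure.pi fun j : Fin m₁ => νl (e₁ j))) =
        fun gZ => K • ∫ h : Fin m₁ → ↥(unitaryGroupOfForm (starRingEnd ℂ) J),
          fF (((c, fun k => (((gZ k * gprimeBlockAt L α (e₂ℕ k.val) S' (c (e₂ℕ k.val)) * (gZ k)⁻¹ : ↥(archLocal L 3 (Matrix.diagonal α) (e₂ℕ k.val))) : GL (Fin 3) ℂ) : Matrix (Fin 3) (Fin 3) ℂ)), fun j => c (e₁ j)), fun j => (((h j * ⟨Matrix.GeneralLinearGroup.mkOfDetNeZero !![(1 : ℂ), 1; 1, -1] det_cayleyTwo_ne_zero * circleDiagonal 2 ![Circle.exp ((c (e₁ j) 0 - c (e₁ j) 2) / 2), Circle.exp (-((c (e₁ j) 0 - c (e₁ j) 2) / 2))] * (Matrix.GeneralLinearGroup.mkOfDetNeZero !![(1 : ℂ), 1; 1, -1] det_cayleyTwo_ne_zero)⁻¹, cayley_conj_circleDiagonal_mem_of_eq_over hJ _⟩ * (h j)⁻¹ : ↥(unitaryGroupOfForm (starRingEnd ℂ) J)) : GL (Fin 2) ℂ) : Matrix (Fin 2) (Fin 2) ℂ)) ∂(Measure.pi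 fun _ : Fin m₁ => μ₀) := by
      funext gZ
      have h := hfFI (c, fun k => (((gZ k * gprimeBlockAt L α (e₂ℕ k.val) S' (c (e₂ℕ k.val)) * (gZ k)⁻¹ : ↥(archLocal L 3 (Matrix.diagonal α) (e₂ℕ k.val))) : GL (Fin 3) ℂ) : Matrix (Fin 3) (Fin 3) ℂ)) (fun j => c (e₁ j)) hcUF hregF
      rw [hΘFdef] at h
      simp only [hΘeq]
      exact h
    -- (6d) the central torus points at the scalar places; the two charts read back
    have hconj : ∀ (g : (k : Fin m₂) → ↥(archLocal L 3 (Matrix.diagonal α) (e₂ℕ k.val))) (k : Fin m₂), (((g k * gprimeBlockAt L α (e₂ℕ k.val) S' (c (e₂ℕ k.val)) * (g k)⁻¹ : ↥(archLocal L 3 (Matrix.diagonal α) (e₂ℕ k.val))) : GL (Fin 3) ℂ) : Matrix (Fin 3) (Fin 3) ℂ) = (((g k * (⟨circleDiagonal 3 (fun i => Circle.exp (x (e₂ℕ k.val) 0) * Circle.exp ((Φ₂ c - Φ₂ x) k i)), circleDiagonal_mem_archLocal_diagonal L 3 α (e₂ℕ k.val) _⟩ : ↥(archLocal L 3 (Matrix.diagonal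 α) (e₂ℕ k.val))) * (g k)⁻¹ : ↥(archLocal L 3 (Matrix.diagonal α) (e₂ℕ k.val))) : GL (Fin 3) ℂ) : Matrix (Fin 3) (Fin 3) ℂ) := by
      intro g k
      rw [conj_gprimeBlockAt_eq_conj_circleDiagonal_centre_of_scalar L α (e₂ℕ k.val) S' (he₂S k) (hxsc k) c (g k)]
      simp only [Pi.sub_apply, hΦ₂]
    have hΦ₁c : ∀ j, (c (e₁ j) 0 - c (e₁ j) 2) / 2 = Φ₁ c j := fun j => (hΦ₁ c j).symm
    have hR : (∏ k : Fin m₂, rootProduct (fun l => c (e₂ℕ k.val) ((lineOf (formSign L α (e₂ℕ k.val))).symm l) - x (e₂ℕ k.val) ((lineOf (formSign L α (e₂ℕ k.val))).symm l))) =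
        ∏ k : Fin m₂, rootProduct ((Φ₂ c - Φ₂ x) k) := by
      refine Finset.prod_congr rfl fun k _ => congrArg rootProduct (funext fun l => ?_)
      rw [Pi.sub_apply, Pi.sub_apply, hΦ₂, hΦ₂]
    have hS : (∏ j : Fin m₁, 2 * Real.sin ((c (e₁ j) 0 - c (e₁ j) 2) / 2)) = ∏ j : Fin m₁, 2 * Real.sin (Φ₁ c j) := by
      refine Finset.prod_congr rfl fun j _ => by rw [hΦ₁c]
    -- (6e) the right-hand side in iterated form
    have hRHS : ((∏ k : Fin m₂, rootProduct ((Φ₂ c - Φ₂ x) k)) • ∫ g : ((k : Fin m₂) → ↥(archLocal L 3 (Matrix.diagonal α) (e₂ℕ k.val))),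
          (fun z' : (({w : InfinitePlace L // IsComplex w} → Fin 3 → ℝ) × (Fin m₁ → ℝ)) × (Fin m₂ → Matrix (Fin 3) (Fin 3) ℂ) =>
        ((∏ k : Fin m₁, 2 * Real.sin (z'.1.2 k)) • ∫ h : Fin m₁ → ↥(unitaryGroupOfForm (starRingEnd ℂ) J),
          (fun y : (({w : InfinitePlace L // IsComplex w} → Fin 3 → ℝ) × (Fin m₂ → Matrix (Fin 3) (Fin 3) ℂ)) × (Fin m₁ → Matrix (Fin 2) (Fin 2) ℂ) => fT (y.1.1, (y.2, y.1.2)))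
            ((z'.1.1, z'.2), fun k => (((h k * ⟨Matrix.GeneralLinearGroup.mkOfDetNeZero !![(1 : ℂ), 1; 1, -1] det_cayleyTwo_ne_zero * circleDiagonal 2 ![Circle.exp (z'.1.2 k), Circle.exp (-(z'.1.2 k))] * (Matrix.GeneralLinearGroup.mkOfDetNeZero !![(1 : ℂ), 1; 1, -1] det_cayleyTwo_ne_zero)⁻¹, cayley_conj_circleDiagonal_mem_of_eq_over hJ _⟩ * (h k)⁻¹ : ↥(unitaryGroupOfForm (starRingEnd ℂ) J)) : GL (Fin 2) ℂ) : Matrix (Fin 2) (Fin 2) ℂ)) ∂(Measure.pi fun _ : Fin m₁ => μ₀)))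
            ((c, Φ₁ c), fun k => (((g k * (⟨circleDiagonal 3 (fun i => Circle.exp (x (e₂ℕ k.val) 0) * Circle.exp ((Φ₂ c - Φ₂ x) k i)), circleDiagonal_mem_archLocal_diagonal L 3 α (e₂ℕ k.val) _⟩ : ↥(archLocal L 3 (Matrix.diagonal α) (e₂ℕ k.val))) * (g k)⁻¹ : ↥(archLocal L 3 (Matrix.diagonal α) (e₂ℕ k.val))) : GL (Fin 3) ℂ) : Matrix (Fin 3) (Fin 3) ℂ))
            ∂(Measure.pi fun k : Fin m₂ => νl (e₂ℕ k.val))) =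
        (((∏ k : Fin m₂, rootProduct ((Φ₂ c - Φ₂ x) k)) : ℝ) : ℂ) * ((((∏ j : Fin m₁, 2 * Real.sin (Φ₁ c j)) : ℝ) : ℂ) *
          ∫ g : ((k : Fin m₂) → ↥(archLocal L 3 (Matrix.diagonal α) (e₂ℕ k.val))), ∫ h : Fin m₁ → ↥(unitaryGroupOfForm (starRingEnd ℂ) J),
            fF (((c, fun k => (((g k * (⟨circleDiagonal 3 (fun i => Circle.exp (x (e₂ℕ k.val) 0) * Circle.exp ((Φ₂ c - Φ₂ x) k i)), circleDiagonal_mem_archLocal_diagonal L 3 α (e₂ℕ k.val) _⟩ : ↥(archLocal L 3 (Matrix.diagonal α) (e₂ℕ k.val))) * (g k)⁻¹ : ↥(archLocal L 3 (Matrix.diagonal α) (e₂ℕ k.val))) : GL (Fin 3) ℂ) : Matrix (Fin 3) (Fin 3) ℂ)), fun j => c (e₁ j)), fun j => (((h j * ⟨Matrix.GeneralLinearGroup.mkOfDetNeZero !![(1 : ℂ), 1; 1, -1] det_cayleyTwo_ne_zero * circleDiagonal 2 ![Circle.exp (Φ₁ c j), Circle.exp (-(Φ₁ c j))] * (Matrix.GeneralLinearGroup.mkOfDetNeZero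 !![(1 : ℂ), 1; 1, -1] det_cayleyTwo_ne_zero)⁻¹, cayley_conj_circleDiagonal_mem_of_eq_over hJ _⟩ * (h j)⁻¹ : ↥(unitaryGroupOfForm (starRingEnd ℂ) J)) : GL (Fin 2) ℂ) : Matrix (Fin 2) (Fin 2) ℂ)) ∂(Measure.pi fun _ : Fin m₁ => μ₀) ∂(Measure.pi fun k : Fin m₂ => νl (e₂ℕ k.val))) := by
      simp only [hfTdef]
      rw [integral_smul, Complex.real_smul, Complex.real_smul]
    -- (6f) the two iterated forms agree (central torus points, face angles)
    have hMID : (∫ g : ((k : Fin m₂) → ↥(archLocal L 3 (Matrix.diagonal α) (e₂ℕ k.val))), ∫ h : Fin m₁ → ↥(unitaryGroupOfForm (starRingEnd ℂ) J),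
          fF (((c, fun k => (((g k * gprimeBlockAt L α (e₂ℕ k.val) S' (c (e₂ℕ k.val)) * (g k)⁻¹ : ↥(archLocal L 3 (Matrix.diagonal α) (e₂ℕ k.val))) : GL (Fin 3) ℂ) : Matrix (Fin 3) (Fin 3) ℂ)), fun j => c (e₁ j)), fun j => (((h j * ⟨Matrix.GeneralLinearGroup.mkOfDetNeZero !![(1 : ℂ), 1; 1, -1] det_cayleyTwo_ne_zero * circleDiagonal 2 ![Circle.exp ((c (e₁ j) 0 - c (e₁ j) 2) / 2), Circle.exp (-((c (e₁ j) 0 - c (e₁ j) 2) / 2))] * (Matrix.GeneralLinearGroup.mkOfDetNeZero !![(1 : ℂ), 1; 1, -1] det_cayleyTwo_ne_zero)⁻¹, cayley_conj_circleDiagonal_mem_of_eq_over hJ _⟩ * (h j)⁻¹ : ↥(unitaryGroupOfForm (starRingEnd ℂ) J)) : GL (Fin 2) ℂ) : Matrix (Fin 2) (Fin 2) ℂ)) ∂(Measure.pi fun _ : Fin m₁ => μ₀) ∂(Measure.pi fun k : Fin m₂ => νl (e₂ℕ k.val))) =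
        ∫ g : ((k : Fin m₂) → ↥(archLocal L 3 (Matrix.diagonal α) (e₂ℕ k.val))), ∫ h : Fin m₁ → ↥(unitaryGroupOfForm (starRingEnd ℂ) J),
            fF (((c, fun k => (((g k * (⟨circleDiagonal 3 (fun i => Circle.exp (x (e₂ℕ k.val) 0) * Circle.exp ((Φ₂ c - Φ₂ x) k i)), circleDiagonal_mem_archLocal_diagonal L 3 α (e₂ℕ k.val) _⟩ : ↥(archLocal L 3 (Matrix.diagonal α) (e₂ℕ k.val))) * (g k)⁻¹ : ↥(archLocal L 3 (Matrix.diagonal α) (e₂ℕ k.val))) : GL (Fin 3) ℂ) : Matrix (Fin 3) (Fin 3) ℂ)), fun j => c (e₁ j)), fun j => (((h j * ⟨Matrix.GeneralLinearGroup.mkOfDetNeZero !![(1 : ℂ), 1; 1, -1] det_cayleyTwo_ne_zero * circleDiagonal 2 ![Circle.exp (Φ₁ c j), Circle.exp (-(Φ₁ c j))] * (Matrix.GeneralLinearGroup.mkOfDetNeZero !![(1 : ℂ), 1; 1, -1] det_cayleyTwo_ne_zero)⁻¹, cayley_conj_circleDiagonal_mem_of_eq_over hJ _⟩ * (h j)⁻¹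 : ↥(unitaryGroupOfForm (starRingEnd ℂ) J)) : GL (Fin 2) ℂ) : Matrix (Fin 2) (Fin 2) ℂ)) ∂(Measure.pi fun _ : Fin m₁ => μ₀) ∂(Measure.pi fun k : Fin m₂ => νl (e₂ℕ k.val)) := by
      refine integral_congr_ae (Filter.Eventually.of_forall fun g => ?_)
      refine integral_congr_ae (Filter.Eventually.of_forall fun h => ?_)
      dsimp only
      have h1 : (fun k : Fin m₂ => (((g k * gprimeBlockAt L α (e₂ℕ k.val) S' (c (e₂ℕ k.val)) * (g k)⁻¹ : ↥(archLocal L 3 (Matrix.diagonal α) (e₂ℕ k.val))) : GL (Fin 3) ℂ) : Matrix (Fin 3) (Fin 3) ℂ)) = fun k => (((g k * (⟨circleDiagonal 3 (fun i => Circle.exp (x (e₂ℕ k.val) 0) * Circle.exp ((Φ₂ c - Φ₂ x) k i)), circleDiagonal_mem_archLocal_diagonal L 3 α (e₂ℕ k.val) _⟩ : ↥(archLocal L 3 (Matrix.diagonal α) (e₂ℕ k.val))) * (g k)⁻¹ : ↥(archLocal L 3 (Matrix.diagonal α) (e₂ℕ k.val))) : GL (Fin 3) ℂ) : Matrix (Fin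 3) (Fin 3) ℂ) := funext fun k => hconj g k
      have h2 : (fun j : Fin m₁ => (((h j * ⟨Matrix.GeneralLinearGroup.mkOfDetNeZero !![(1 : ℂ), 1; 1, -1] det_cayleyTwo_ne_zero * circleDiagonal 2 ![Circle.exp ((c (e₁ j) 0 - c (e₁ j) 2) / 2), Circle.exp (-((c (e₁ j) 0 - c (e₁ j) 2) / 2))] * (Matrix.GeneralLinearGroup.mkOfDetNeZero !![(1 : ℂ), 1; 1, -1] det_cayleyTwo_ne_zero)⁻¹, cayley_conj_circleDiagonal_mem_of_eq_over hJ _⟩ * (h j)⁻¹ : ↥(unitaryGroupOfForm (starRingEnd ℂ) J)) : GL (Fin 2) ℂ) : Matrix (Fin 2) (Fin 2) ℂ)) = fun j => (((h j * ⟨Matrix.GeneralLinearGroup.mkOfDetNeZero !![(1 : ℂ), 1; 1, -1] det_cayleyTwo_ne_zero * circleDiagonal 2 ![Circle.exp (Φ₁ c j), Circle.exp (-(Φ₁ c j))] * (Matrix.GeneralLinearGroup.mkOfDetNeZero !![(1 : ℂ), 1; 1, -1] det_cayleyTwo_ne_zero)⁻¹, cayley_conj_circleDiagonal_mem_of_eq_over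 hJ _⟩ * (h j)⁻¹ : ↥(unitaryGroupOfForm (starRingEnd ℂ) J)) : GL (Fin 2) ℂ) : Matrix (Fin 2) (Fin 2) ℂ) := by
        funext j; simp only [hΦ₁c]
      rw [h1, h2]
    -- (6g) assemble: PKG-T identity, split, descend, dress
    have hfc := hfacT c ⟨hcU₀, hcreg⟩
    rw [hI2', hI3, integral_smul, Complex.real_smul, hMID] at hfc
    rw [hRHS, orbFamGExt_of_mem_regG L α ν' a' S' hcreg, hfc, hvfac c, hR, hS]
    ring
  -- STEP 7: the junction ★ `…_of_mixedModel`
  have hΦ₁x : Φ₁ x = 0 := by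
    funext j; rw [hΦ₁, (hface j).1, sub_self, zero_div]; rfl
  have hΦ₁ne : ∀ c ∈ U' ∩ RegG S', ∀ j : Fin m₁, Φ₁ c j ≠ 0 := fun c hc j => by
    rw [hΦ₁]; exact half_sub_ne_zero_of_mem_regG S' (he₁S j) hc.2
  have hΦ₂inj : ∀ c ∈ U' ∩ RegG S', ∀ k : Fin m₂, Injective (Φ₂ c k - Φ₂ x k) := fun c hc k => by
    have h := injective_sub_relabel_of_mem_regG S' (he₂S k) (hxsc k) (lineOf (formSign L α (e₂ℕ k.val))) hc.2
    refine fun l l' hll' => h ?_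
    simpa only [Pi.sub_apply, hΦ₂] using hll'
  have hfT : ContDiffOn ℝ ∞ fT ((univ : Set ({w : InfinitePlace L // IsComplex w} → Fin 3 → ℝ)) ×ˢ univ) := by
    rw [hfTdef]
    refine ContDiff.contDiffOn (hfF.comp ?_)
    exact ((contDiff_fst.prodMk (contDiff_snd.comp contDiff_snd)).prodMk
      ((contDiff_pi.2 fun j => (contDiff_apply ℝ (Fin 3 → ℝ) (e₁ j)).comp contDiff_fst))).prodMk (contDiff_fst.comp contDiff_snd)
  have hfTC₁ : ∀ (q : {w : InfinitePlace L // IsComplex w} → Fin 3 → ℝ) (X : (Fin m₁ → Matrix (Fin 2) (Fin 2) ℂ) × (Fin m₂ → Matrix (Fin 3) (Fin 3) ℂ)),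
      (∃ k, X.1 k ∉ C') → fT (q, X) = 0 := fun q X hX => by
    rw [hfTdef]; exact hfFC _ _ hX
  have hfTC₂ : ∀ (q : {w : InfinitePlace L // IsComplex w} → Fin 3 → ℝ) (X : (Fin m₁ → Matrix (Fin 2) (Fin 2) ℂ) × (Fin m₂ → Matrix (Fin 3) (Fin 3) ℂ)),
      (∃ k, X.2 k ∉ C) → fT (q, X) = 0 := fun q X hX => by
    rw [hfTdef]
    exact hfFZ (q, X.2) (fun X₁ => hΘFC₂ q X.2 X₁ hX) _ _
  have hu : ContDiffOn ℝ ∞ uu U' := by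
    rw [huudef]; exact ((hv.contDiffOn.mul (hu₀.mono fun c hc => hc.1.2)).mul contDiffOn_const)
  have hAQ : MapsTo A U' (univ : Set ({w : InfinitePlace L // IsComplex w} → Fin 3 → ℝ)) := mapsTo_univ _ _
  have h1 : ContDiffOn ℝ ∞ (orbFamGExt L α ν' a' S') (InRegG (slotSign L α) S') := contDiffOn_orbFamGExt_inRegG L α ν' S' hα hreal hS' ha'
  exact exists_nhds_bddAbove_norm_iteratedFDeriv_orbFamGExt_of_mixedModel L α ν' a' S' hα hreal hJ μ₀ νl ζ e₂ℕ m₁ m₂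
    A hU'n isOpen_univ hAQ Φ₁ hΦ₁x hΦ₁ne Φ₂ hΦ₂inj fT hfT hC' hfTC₁ hC hfTC₂ uu hu hmodel h1 n

/-! ## EDITION 2 — HYPOTHESIS-FREE: the organ O-L1d′-N over ★ (M2) `exists_descent_box_localOrbitalIntegral_param` ∘ ★ (S-ad) `exists_desc_of_localDescent` -/

/-- **(I₁) AT (0,2)-NORMALISED MIXED CORNERS — HYPOTHESIS-FREE.**  The organ O-L1d′-N of the LH3 leaf v9 (`HcCentralMixedJetBoundsNormalisedStatement` after the L1 frame,
token for token): EDITION 1's `…_of_desc` with its descent schema `hdesc` DISCHARGED by LH3-p04 (g4)'s ★ (M2) one-place parametric box descent (`K : ℝ`, clause (Z) inside,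
raw Cayley torus) read through F0P3a-p05 (g21)'s ★ (S-ad) centre-absorption adapter.  The leaf pays
`stub_N9hcCentralMixedJetBoundsNormalised := fun L _ _ _ α _ _ ν' _ _ hherm hanis a' ha' => exists_nhds_bddAbove_norm_iteratedFDeriv_orbFamGExt_of_mixedCorner_normalised L α ν' hherm hanis a' ha'`.
[cite: Varadarajan1977, Part I §1.12, §3] [cite: Bouaziz1994IntegralesOrbitales, §3.1 (I₁)–(I₂) p. 579; §3.2 p. 580] [cite: Shelstad1979, §4 pp. 22–25]
[cite: Rogawski1990, §4.12 Lemma 4.12.1; §8.2 pp. 118–124] [cite: WarnerHASSLG2, Thm. 8.4.3.1] [cite: HormanderALPDO1, §1.1 Thms. 1.1.8, 1.1.9] -/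
theorem exists_nhds_bddAbove_norm_iteratedFDeriv_orbFamGExt_of_mixedCorner_normalised
    (hherm : ((Matrix.diagonal α).map (cmConjRingHom L)).transpose = Matrix.diagonal α)
    (hanis : ∀ x : Fin 3 → L, Literature.AlgebraicGeometry.ShimuraVarieties.hermForm (cmConjRingHom L) (Matrix.diagonal α) x x = 0 → x = 0)
    (a' : ↥(arch (↥(maximalRealSubfield L)) L (IsCMField.complexConj L) 3 (Matrix.diagonal α)) → ℂ) (ha' : ArchSmooth L 3 (Matrix.diagonal α) a') :
    ∀ (S' : Finset {w : InfinitePlace L // IsComplex w}), (∀ w, w ∈ S' → w ∈ splitChartPlaces L α) →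
      ∀ (n : ℕ) (x : {w : InfinitePlace L // IsComplex w} → Fin 3 → ℝ),
      (∀ w' : {w : InfinitePlace L // IsComplex w}, w' ∉ S' → ∀ l : Fin 3, x w' l ∈ Ico 0 (2 * Real.pi)) →
      (∃ w : {w : InfinitePlace L // IsComplex w}, w ∉ S' ∧ (∃ i j : Fin 3, i ≠ j ∧ slotSign L α w i ≠ slotSign L α w j) ∧
        (∀ l l' : Fin 3, Circle.exp (x w l) = Circle.exp (x w l')) ∧
        ∃ w', w' ∉ S' ∧ w' ≠ w ∧ ∃ i' j' : Fin 3, i' ≠ j' ∧ slotSign L α w' i' ≠ slotSign L α w' j' ∧ Circle.exp (x w' i') = Circle.exp (x w' j')) →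
      (∀ w' : {w : InfinitePlace L // IsComplex w}, w' ∉ S' → slotSign L α w' 1 ≠ slotSign L α w' 2 →
        Circle.exp (x w' 1) = Circle.exp (x w' 2) → Circle.exp (x w' 0) = Circle.exp (x w' 1)) →
      ∃ U ∈ 𝓝 x, BddAbove ((fun c => ‖iteratedFDeriv ℝ n (orbFamGExt L α ν' a' S') c‖) '' (U ∩ InRegG (slotSign L α) S')) := by
  have hα : ∀ i, α i ≠ 0 := ne_zero_of_diagonal_anisotropic hanis
  have hreal : ∀ (w' : {w : InfinitePlace L // IsComplex w}) (i : Fin 3), (w'.1.embedding (α i)).im = 0 :=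
    im_embedding_diagonal_eq_zero L 3 α (complexConj_apply_eq_of_diagonal_frame hherm)
  refine exists_nhds_bddAbove_norm_iteratedFDeriv_orbFamGExt_of_mixedCorner_normalised_of_desc L α ν' hherm hanis a' ha' ?_
  intro J hJ _ _ _ _ μ₀ _ _ S' hS' w hw hwsp pw h02 h01 _ _ νw _ _ P _ _ _ Θ hΘ C hC hΘC
  obtain ⟨K, U, f, C', -, hU, hpw, hf, hC', hfC', hZ, -, hI⟩ :=
    exists_descent_box_localOrbitalIntegral_param L α hα hreal hJ μ₀ hS' hw hwsp h02 h01 νw Θ hΘ ⟨C, hC, hΘC⟩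
  exact exists_desc_of_localDescent hJ μ₀ L α S' w νw Θ (K : ℂ) hU hpw hf hC' hfC' hZ
    (fun ξ cw hcw hinj => by rw [← Complex.real_smul]; exact hI ξ cw hcw hinj)

end Closer

end Literature.NumberTheory.Rogawski1990

end
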